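import Summits.CriticalPhenomena.SAWScalingLimit.Theses.SAWIsotropicAnchor
import Literature.Probability.RandomPlanarGeometry.ChordalRestrictionMarkov
import HarnessLib

/-!
# Birth skeleton for the split child X3 `AnchorMarkovKernel` of `AnchorAxiomsOfLimit` (stmt-CriticalPhenomena-7299)

`AnchorMarkovKernel` (third child of the strategist's split, route SAWIsotropicAnchor — the HARDEST piece;
= `stub_anchorMarkovKernel` of `Lines/split.lean`): every chordal full scaling limit `P` of the critical
freely-jointed non-crossing chain that has the restriction property and is carried by simple
boundary-avoiding curves admits a restriction-coupled domain-Markov kernel: `P.IsRestrictionMarkov`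
(`∃ Q, P.IsMarkovExtension Q ∧ P.IsRestrictionKernel Q`).

## The cut (off-lattice twin of `Cruxes/AxiomsOfLimit/Lines/markov_birth.lean`): the kernel IS the scaling
## limit of the chain in SLIT domains

The chain is Markov IN ITS TIP at step times, exactly: conditionally on the first `k` steps, the remaining
steps form the critical chain of the SLIT domain `Ω ∖ (first k segments)` started at the tip (LSW04 §2.3 for
the lattice walk; for the chain the past is a polygonal slit of zero width). So the candidate for `Q D past`
is the full limit of `fjc ℓ (remainingDomain D past) a'(ℓ) b'(ℓ)` along SLIT-ADMISSIBLE approximations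
(`IsSlitAdm`: `a' ℓ →` the tip `past.target`, `b' ℓ → b`, the slit-domain law eventually a probability
measure), and the zero measure where no slit-admissible approximation exists (`IsSlitLimitKernel`).

* S1 `stub_slitLimitKernel` (HARDEST, XL) — EXISTENCE OF THE SLIT-DOMAIN LIMITS AS A MARKOV EXTENSION: for
  every chordal full limit `P` with restriction and simplicity there is `Q` with `IsSlitLimitKernel fjc Q` and
  `P.IsMarkovExtension Q`: (a) the chain converges in every slit domain that arises (extension of `(lim)` from
  Jordan to slit domains); (b) the exact tip-Markov identity passes to the limit as the disintegration clause
  `markov`, which needs the slit limits to be CONTINUOUS in the slit as the polygonal past converges to the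
  limit past (stability under perturbation near the tip, incl. the mid-step hitting of the stopping set — the
  crux's recorded why-might-fail); (c) `initial` is `(lim)` + uniqueness of weak limits
  (`remainingDomain_mk_const`); `domain` holds by construction.
* S2 `stub_slitRestrictionKernel` (L–XL) — RESTRICTION PASSAGE IN SLIT DOMAINS: for such `Q`, conditioned into
  a Dobrushin sub-domain `D' ⊆ remainingDomain D past` pinned at the tip and at `b`, `Q D past` is `P D'`
  (the exact conditioning identity of the chain holds in slit domains verbatim; the passage is the slit
  analogue of the child `AnchorRestriction`; `0 = 0` off the slit-approximable configurations).

`AnchorMarkovKernel_of : S1 → S2 → AnchorMarkovKernel` takes `Q` from S1 with its Markov-extension clause and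
the kernel clause from S2 (`IsRestrictionMarkov.intro`).

References: G. F. Lawler, O. Schramm, W. Werner, *On the scaling limit of planar self-avoiding walk* (2004),
arXiv:math/0204277, §2.3, §3.4.5; W. Werner, *Lectures on two-dimensional critical percolation* (2007),
§3.2 (2); O. Schramm (2000), §1. All [folklore] at the level of statements.
-/

noncomputable section

open scoped BigOperators Topology Classical MeasureTheory ProbabilityTheory ComplexConjugate ContinuousMap ENNReal
open MeasureTheory Filter Set Function TopologicalSpace
open Literature.Probability.LatticeModels Literature.Probability.RandomPlanarGeometry

namespace Summit.CriticalPhenomena.SAWScalingLimit.Cruxes.AnchorAxiomsOfLimit.MarkovBirth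

/-- **The split child X3 `AnchorMarkovKernel`** (verbatim the statement filed for the route-level split;
= `stub_anchorMarkovKernel` of `Lines/split.lean`). [cite: LawlerSchrammWerner2004SAW, §2.3] -/
def AnchorMarkovKernel : Prop :=
  let fjc : ℝ → Set ℂ → ℂ → ℂ → MeasureTheory.Measure (Literature.Probability.RandomPlanarGeometry.CurveClass ℂ) := fun ℓ Ω x y => (let S : (N : ℕ) → (Fin N → ℝ) → Fin (N + 1) → ℂ := fun N θ k => ∑ j : Fin N, if (j : ℕ) < (k : ℕ) then Complex.exp (Complex.I * (θ j : ℂ)) else 0; let C : (N : ℕ) → (Fin (N + 1) → ℂ) → Literature.Probability.RandomPlanarGeometry.CurveClass ℂ := fun _ v => Literature.Probability.RandomPlanarGeometry.CurveClass.mk ⟨Literature.Probability.LatticeModels.polyline (List.ofFn v)⟩; let Z : ℕ → ℝ := fun N => ((MeasureTheory.volume : MeasureTheory.Measure (Fin N → ℝ)) {θ | (∀ j, θ j ∈ Set.Ico (0 : ℝ) (2 * Real.pi)) ∧ C N (S N θ) ∈ Literature.Probability.RandomPlanarGeometry.CurveClass.simple}).toReal / (2 * Real.pi) ^ N; let μ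 : ℝ := ⨅ N : ℕ, Z (N + 1) ^ (1 / ((N : ℝ) + 1)); let V : (N : ℕ) → ℂ × (Fin N → ℝ) → Literature.Probability.RandomPlanarGeometry.CurveClass ℂ := fun N p => C N (fun k => p.1 + (ℓ : ℂ) * S N p.2 k); let E : Set (Literature.Probability.RandomPlanarGeometry.CurveClass ℂ) := {c | c ∈ Literature.Probability.RandomPlanarGeometry.CurveClass.simple ∧ c.range ⊆ closure Ω ∧ c.target ∈ Metric.ball y ℓ}; let W : MeasureTheory.Measure (Literature.Probability.RandomPlanarGeometry.CurveClass ℂ) := MeasureTheory.Measure.sum fun N : ℕ => ENNReal.ofReal ((μ⁻¹ / (2 * Real.pi)) ^ N) • ((((MeasureTheory.volume.restrict (Metric.ball x ℓ)).prod (MeasureTheory.volume.restrict (Set.univ.pi fun _ : Fin N => Set.Ico (0 : ℝ) (2 * Real.pi)))).restrict (V N ⁻¹' E)).map (V N)); (W Set.univ)⁻¹ • W); ∀ P : Literature.Probability.RandomPlanarGeometry.ChordalFamily, P.IsChordal → (∀ D : Literature.Probability.RandomPlanarGeometry.DobrushinDomain, ∃ a' b' : ℝ → ℂ, (Filter.Tendsto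 a' (nhdsWithin 0 (Set.Ioi 0)) (nhds (D.pt 0)) ∧ Filter.Tendsto b' (nhdsWithin 0 (Set.Ioi 0)) (nhds (D.pt 1)) ∧ ∀ᶠ ℓ in nhdsWithin 0 (Set.Ioi 0), MeasureTheory.IsProbabilityMeasure (fjc ℓ D.carrier (a' ℓ) (b' ℓ)))) → (∀ (D : Literature.Probability.RandomPlanarGeometry.DobrushinDomain) (a' b' : ℝ → ℂ), (Filter.Tendsto a' (nhdsWithin 0 (Set.Ioi 0)) (nhds (D.pt 0)) ∧ Filter.Tendsto b' (nhdsWithin 0 (Set.Ioi 0)) (nhds (D.pt 1)) ∧ ∀ᶠ ℓ in nhdsWithin 0 (Set.Ioi 0), MeasureTheory.IsProbabilityMeasure (fjc ℓ D.carrier (a' ℓ) (b' ℓ))) → Literature.Probability.RandomPlanarGeometry.TendstoLaw (fun (_ : ℝ) (c : Literature.Probability.RandomPlanarGeometry.CurveClass ℂ) => c) (fun ℓ => fjc ℓ D.carrier (a' ℓ) (b' ℓ)) id (P D)) → P.IsRestriction → (∀ D : Literature.Probability.RandomPlanarGeometry.DobrushinDomain, ∀ᵐ γ ∂(P D), γ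 ∈ Literature.Probability.RandomPlanarGeometry.CurveClass.simple ∧ γ.range ∩ frontier D.carrier ⊆ {D.pt 0, D.pt 1}) → P.IsRestrictionMarkov

/-! ### Vocabulary (the anchor law named; admissibility; full limit) — as in `Lines/split.lean` -/

/-- The critical freely-jointed non-crossing chain law, verbatim the `let fjc := …` inlined in the
route items. [cite: LawlerSchrammWerner2004SAW, §3.4.2] -/
def fjc : ℝ → Set ℂ → ℂ → ℂ → MeasureTheory.Measure (Literature.Probability.RandomPlanarGeometry.CurveClass ℂ) :=
  fun ℓ Ω x y => (let S : (N : ℕ) → (Fin N → ℝ) → Fin (N + 1) → ℂ := fun N θ k => ∑ j : Fin N, if (j : ℕ) < (k : ℕ) then Complex.exp (Complex.I * (θ j : ℂ)) else 0; let C : (N : ℕ) → (Fin (N + 1) → ℂ) → Literature.Probability.RandomPlanarGeometry.CurveClass ℂ := fun _ v => Literature.Probability.RandomPlanarGeometry.CurveClass.mk ⟨Literature.Probability.LatticeModels.polyline (List.ofFn v)⟩; let Z : ℕ → ℝ := fun N => ((MeasureTheory.volume : MeasureTheory.Measure (Fin N → ℝ)) {θ | (∀ j, θ j ∈ Set.Ico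 (0 : ℝ) (2 * Real.pi)) ∧ C N (S N θ) ∈ Literature.Probability.RandomPlanarGeometry.CurveClass.simple}).toReal / (2 * Real.pi) ^ N; let μ : ℝ := ⨅ N : ℕ, Z (N + 1) ^ (1 / ((N : ℝ) + 1)); let V : (N : ℕ) → ℂ × (Fin N → ℝ) → Literature.Probability.RandomPlanarGeometry.CurveClass ℂ := fun N p => C N (fun k => p.1 + (ℓ : ℂ) * S N p.2 k); let E : Set (Literature.Probability.RandomPlanarGeometry.CurveClass ℂ) := {c | c ∈ Literature.Probability.RandomPlanarGeometry.CurveClass.simple ∧ c.range ⊆ closure Ω ∧ c.target ∈ Metric.ball y ℓ}; let W : MeasureTheory.Measure (Literature.Probability.RandomPlanarGeometry.CurveClass ℂ) := MeasureTheory.Measure.sum fun N : ℕ => ENNReal.ofReal ((μ⁻¹ / (2 * Real.pi)) ^ N) • ((((MeasureTheory.volume.restrict (Metric.ball x ℓ)).prod (MeasureTheory.volume.restrict (Set.univ.pi fun _ : Fin N => Set.Ico (0 : ℝ) (2 * Real.pi)))).restrict (V N ⁻¹' E)).map (V N)); (W Set.univ)⁻¹ • W)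

variable {F : ℝ → Set ℂ → ℂ → ℂ → Measure (CurveClass ℂ)} {P : ChordalFamily}

/-- Admissible endpoint approximation of `D` for the law family `F` (verbatim the inlined clause). [folklore] -/
def Adm (F : ℝ → Set ℂ → ℂ → ℂ → Measure (CurveClass ℂ)) (D : DobrushinDomain) (a' b' : ℝ → ℂ) : Prop :=
  Filter.Tendsto a' (nhdsWithin 0 (Set.Ioi 0)) (nhds (D.pt 0)) ∧
    Filter.Tendsto b' (nhdsWithin 0 (Set.Ioi 0)) (nhds (D.pt 1)) ∧
      ∀ᶠ ℓ in nhdsWithin 0 (Set.Ioi 0), MeasureTheory.IsProbabilityMeasure (F ℓ D.carrier (a' ℓ) (b' ℓ))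

/-- `(approx)`: every Dobrushin domain admits an admissible approximation. [folklore] -/
def Approx (F : ℝ → Set ℂ → ℂ → ℂ → Measure (CurveClass ℂ)) : Prop :=
  ∀ D : DobrushinDomain, ∃ a' b' : ℝ → ℂ, Adm F D a' b'

/-- `(lim)`: `P` is the full scaling limit of `F` along every admissible approximation. [folklore] -/
def Lim (F : ℝ → Set ℂ → ℂ → ℂ → Measure (CurveClass ℂ)) (P : ChordalFamily) : Prop :=
  ∀ (D : DobrushinDomain) (a' b' : ℝ → ℂ), Adm F D a' b' →
    TendstoLaw (fun (_ : ℝ) (c : CurveClass ℂ) => c) (fun ℓ => F ℓ D.carrier (a' ℓ) (b' ℓ)) id (P D)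

/-- Clause (5): simple curves meeting `∂D` only at the marked points. [folklore] -/
def SimpleBd (P : ChordalFamily) : Prop :=
  ∀ D : DobrushinDomain, ∀ᵐ γ ∂(P D), γ ∈ CurveClass.simple ∧ γ.range ∩ frontier D.carrier ⊆ {D.pt 0, D.pt 1}

/-- **Slit-admissible approximation** of the configuration `(D, past)`: interior points `a' ℓ →` the tip
`past.target`, `b' ℓ → b = D.pt 1`, with the chain law of the slit domain `remainingDomain D past`
eventually a probability measure — the slit analogue of `Adm`. [folklore] -/
structure IsSlitAdm (F : ℝ → Set ℂ → ℂ → ℂ → Measure (CurveClass ℂ)) (D : DobrushinDomain)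
    (past : CurveClass ℂ) (a' b' : ℝ → ℂ) : Prop where
  /-- `a' ℓ →` the tip -/
  tendsto_fst : Tendsto a' (𝓝[>] (0 : ℝ)) (𝓝 past.target)
  /-- `b' ℓ → b` -/
  tendsto_snd : Tendsto b' (𝓝[>] (0 : ℝ)) (𝓝 (D.pt 1))
  /-- the slit-domain law is eventually a probability measure -/
  eventually_prob : ∀ᶠ ℓ in 𝓝[>] (0 : ℝ),
    IsProbabilityMeasure (F ℓ (remainingDomain D past) (a' ℓ) (b' ℓ))

/-- **`Q` is the slit-domain scaling-limit kernel of the chain**: whenever `(D, past)` admits a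
slit-admissible approximation, the chain laws of the slit domain converge weakly along `ℓ → 0⁺` to
`Q D past` for EVERY slit-admissible approximation; otherwise `Q D past = 0`. [cite: LawlerSchrammWerner2004SAW, §2.3] -/
def IsSlitLimitKernel (F : ℝ → Set ℂ → ℂ → ℂ → Measure (CurveClass ℂ))
    (Q : DobrushinDomain → CurveClass ℂ → Measure (CurveClass ℂ)) : Prop :=
  (∀ (D : DobrushinDomain) (past : CurveClass ℂ) (a' b' : ℝ → ℂ), IsSlitAdm F D past a' b' →
      TendstoLaw (fun (_ : ℝ) (c : CurveClass ℂ) => c)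
        (fun ℓ => F ℓ (remainingDomain D past) (a' ℓ) (b' ℓ)) id (Q D past)) ∧
    ∀ (D : DobrushinDomain) (past : CurveClass ℂ),
      (¬ ∃ a' b' : ℝ → ℂ, IsSlitAdm F D past a' b') → Q D past = 0

/-! ### The stubs (the ONLY `sorry`s of this file) -/

/-- **S1 (hardest) — the slit-domain limits of the chain exist and form a Markov extension** of every
chordal full limit with restriction and simplicity. [cite: LawlerSchrammWerner2004SAW, §2.3] -/
theorem stub_slitLimitKernel :
    ∀ P : ChordalFamily, P.IsChordal → Approx fjc → Lim fjc P → P.IsRestriction → SimpleBd P →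
      ∃ Q : DobrushinDomain → CurveClass ℂ → Measure (CurveClass ℂ),
        IsSlitLimitKernel fjc Q ∧ P.IsMarkovExtension Q := by
  sorry

/-- **S2 — restriction passes to the slit-domain limits**: a slit-limit kernel that is a Markov extension
of a chordal full limit with restriction is a restriction kernel (`P.IsRestrictionKernel Q`).
[cite: LawlerSchrammWerner2004SAW, §3.4.5] -/
theorem stub_slitRestrictionKernel :
    ∀ (P : ChordalFamily) (Q : DobrushinDomain → CurveClass ℂ → Measure (CurveClass ℂ)),
      P.IsChordal → Approx fjc → Lim fjc P → P.IsRestriction → IsSlitLimitKernel fjc Q →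
        P.IsMarkovExtension Q → P.IsRestrictionKernel Q := by
  sorry

/-! ### Name-keyed aliases (skeleton-check convention) -/

namespace __Registered

/-- Alias keyed by the registered stub name. -/
abbrev stub_slitLimitKernel : Prop :=
  ∀ P : ChordalFamily, P.IsChordal → Approx fjc → Lim fjc P → P.IsRestriction → SimpleBd P →
    ∃ Q : DobrushinDomain → CurveClass ℂ → Measure (CurveClass ℂ),
      IsSlitLimitKernel fjc Q ∧ P.IsMarkovExtension Q
/-- Alias keyed by the registered stub name. -/
abbrev stub_slitRestrictionKernel : Prop :=
  ∀ (P : ChordalFamily) (Q : DobrushinDomain → CurveClass ℂ → Measure (CurveClass ℂ)),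
    P.IsChordal → Approx fjc → Lim fjc P → P.IsRestriction → IsSlitLimitKernel fjc Q →
      P.IsMarkovExtension Q → P.IsRestrictionKernel Q

end __Registered

/-- The child IS the generic kernel piece at the named law (definitionally). [folklore] -/
theorem anchorMarkovKernel_iff :
    AnchorMarkovKernel ↔ ∀ P : ChordalFamily, P.IsChordal → Approx fjc → Lim fjc P → P.IsRestriction →
      SimpleBd P → P.IsRestrictionMarkov :=
  Iff.rfl

/-! ### The skeleton theorem -/

/-- **`AnchorMarkovKernel` from S1 and S2** (no `sorry` of its own): take the slit-limit kernel `Q` of S1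
with its Markov-extension clause, and the restriction-kernel clause from S2. [folklore] -/
theorem AnchorMarkovKernel_of (h₁ : __Registered.stub_slitLimitKernel)
    (h₂ : __Registered.stub_slitRestrictionKernel) : AnchorMarkovKernel :=
  anchorMarkovKernel_iff.2 fun P hch happ hlim hr hs => by
    obtain ⟨Q, hK, hM⟩ := h₁ P hch happ hlim hr hs
    exact ChordalFamily.IsRestrictionMarkov.intro hM (h₂ P Q hch happ hlim hr hK hM)

/-- Wiring check. -/
example : AnchorMarkovKernel := AnchorMarkovKernel_of stub_slitLimitKernel stub_slitRestrictionKernel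

end Summit.CriticalPhenomena.SAWScalingLimit.Cruxes.AnchorAxiomsOfLimit.MarkovBirth

end
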